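import Literature.Probability.LatticeModels.CurrentsPartialMonotonicity
import Literature.Probability.LatticeModels.AizenmanWickSplice
import HarnessLib

/-!
# The disentangling bound for the intersection of double-current clusters (Aizenman 1982; Aizenman–Duminil-Copin 2021, Cor. A.2 and eq. (3.13))

Topic `Literature/Probability/LatticeModels`. For edge couplings `K ≥ 0` on a finite simple graph `G`
(`WeightedCurrents.lean`; `ℝ≥0∞` current sums `Z[A] = ecurrentSum K A`, pair weights
`epairWeight K A B (n₁,n₂) = 1{∂n₁=A}1{∂n₂=B} w(n₁)w(n₂)`, clusters `C_n(x) = Current.cluster n x`),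
this file proves the finite-volume statements behind

* M. Aizenman, H. Duminil-Copin, *Marginal triviality of the scaling limits of critical 4D Ising and
  `φ⁴₄` models*, Ann. of Math. **194** (2021), arXiv:1912.07973 [AizenmanDuminilCopinAnnals2021]:
  **Appendix A.1, Corollary A.2, first inequality** ("For every `β > 0`, every four vertices
  `x,y,z,t ∈ ℤ^d` … `P^{xy,zt}_β[C_{n₁+n₂}(x) ∩ C_{n₁+n₂}(z) ≠ ∅] ≤ P^{xy,∅,zt}_β[C_{n₁+n₂}(x) ∩ C_{n₃}(z) ≠ ∅]`
  … The first inequality appeared in [Aiz82]"; proof: "Fix `β > 0`, `Λ` finite (the claim will then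
  follow by letting `Λ` tend to `ℤ^d`)"), and **§3.2, eq. (3.13)** ("As proved in [Aiz82], and
  recalled here in the Appendix, the probability of an intersection can only increase upon the two
  sets' replacement by a pair of independently distributed clusters defined through the addition of
  two sourceless currents: `P^{xy,zt}_β[C_{n₁+n₂}(x) ∩ C_{n₁+n₂}(z) ≠ ∅] ≤ P^{xy,zt,∅,∅}_β[C_{n₁+n₃}(x) ∩ C_{n₂+n₄}(z) ≠ ∅]`"),
  the starting point (3.14) of the whole intersection analysis (§4, §6.1).

In un-normalised form (multiply by `Z[xy] Z[zt] Z[∅]` resp. `Z[xy] Z[zt] Z[∅]²`; within one current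
configuration `C(x) ∩ C(z) ≠ ∅ ⇔ z ∈ C(x)`):

* `Current.tsum_inter_pair_mul_le_three` — **Cor. A.2, first inequality**:
  `Z[∅] · ∑ 1{∂n₁=xy}1{∂n₂=zt} w w 𝟙[z ∈ C_{n₁+n₂}(x)]`
  `≤ ∑ 1{∂n₁=xy}1{∂n₂=∅}1{∂n₃=zt} w w w 𝟙[C_{n₁+n₂}(x) ∩ C_{n₃}(z) ≠ ∅]`;
* `Current.tsum_inter_pair_mul_sq_le_four` — **eq. (3.13)**:
  `Z[∅]² · ∑ 1{∂n₁=xy}1{∂n₂=zt} w w 𝟙[z ∈ C_{n₁+n₂}(x)]`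
  `≤ ∑ 1{∂n₁=xy}1{∂n₃=∅} 1{∂n₂=zt}1{∂n₄=∅} w⁴ 𝟙[C_{n₁+n₃}(x) ∩ C_{n₂+n₄}(z) ≠ ∅]`.

The left-hand sum is the intersection term `P` of the tree's random-current identity for `U₄`
(`Current.ursellFour_currentSum_identity`: `… = Z[xyzt]Z[∅] + 2P`), so this is
`|U₄| ≤ 2⟨σ_xσ_y⟩⟨σ_zσ_t⟩ P^{xy,∅} ⊗ P^{zt,∅}[C_{n₁+n₃}(x) ∩ C_{n₂+n₄}(z) ≠ ∅]` (ADC (3.14)).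

## Proof

As printed for Cor. A.2, through the complementary events. By Lemma A.1
(`Current.tsum_epairWeight_mul_eq_sum_cluster`, frozen cluster `T = C_{n₁+n₂}(x)`) the non-intersection
mass `∑ 1{xy}1{zt} w w 𝟙[z ∉ C(x)]` is `∑_T inner(T) · Z_{G∖T}[zt]`, while the three-current
non-intersection mass is `∑_T inner(T) · V(T) · Z_{G∖T}[∅]` with
`V(T) = ∑ 1{∂n=zt} w 𝟙[C_n(z) ∩ T = ∅]`; and `V(T) · Z_{G∖T}[∅] ≤ Z_{G∖T}[zt] · Z[∅]`
(`Current.avoidMass_mul_le`: resolving by the cluster `C = C_n(z)`, the conditioned masses compare by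
Griffiths' inequality in the form `Current.cmass_empty_mul_le` of `AizenmanWickSplice.lean` — this is the
printed "Griffiths' inequality [Gri67], and the trivial inclusion" step, done cluster by cluster).
Complements are then exchanged using `𝟙[·] + 𝟙[¬·] = 1` and finiteness. The fourth (sourceless) current
only enlarges `C(z)`. No named fact is introduced; everything is proved.

## References

* M. Aizenman, H. Duminil-Copin, Ann. of Math. 194 (2021), arXiv:1912.07973, §3.2 (3.13)–(3.14) and
  Appendix A.1, Corollary A.2 with its proof [AizenmanDuminilCopinAnnals2021].
* M. Aizenman, *Geometric analysis of φ⁴ fields and Ising models*, Comm. Math. Phys. 86 (1982), §5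
  (the original disentangling, Prop. 5.3's proof) [Aizenman1982] — through `AizenmanWickSplice.lean`.
-/

noncomputable section

open Finset Filter
open scoped symmDiff ENNReal

namespace Literature.Probability.LatticeModels

variable {V : Type*} [Fintype V] [DecidableEq V] {G : SimpleGraph V} [DecidableRel G.Adj]

namespace Current

variable {K : G.edgeFinset → ℝ}

/-! ### The single-current avoidance mass `V(T) = ∑ 1{∂n = zt} w 𝟙[C_n(z) ∩ T = ∅]` -/

/-- The mass of the currents with sources `{z} Δ {t}` whose cluster of `z` avoids the vertex set `T`:
`V(T) = ∑_n 1{∂n = {z,t}} w(n) 𝟙[C_n(z) ∩ T = ∅]` (`= Z[zt] · P^{zt}[C_n(z) ∩ T = ∅]`). [folklore] -/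
def avoidMass (K : G.edgeFinset → ℝ) (z t : V) (T : Finset V) : ℝ≥0∞ :=
  ∑' n : Current G, (if n.sources = {z} ∆ {t} then n.eweight K else 0) *
    (if Disjoint (n.cluster z) T then 1 else 0)

/-- `V(T) = 0` if `z ∈ T` or `t ∈ T` (`z, t ∈ C_n(z)` for `∂n = {z,t}`). [folklore] -/
theorem avoidMass_eq_zero_of_mem (K : G.edgeFinset → ℝ) {z t : V} {T : Finset V} (h : z ∈ T ∨ t ∈ T) :
    avoidMass K z t T = 0 := by
  unfold avoidMass
  refine ENNReal.tsum_eq_zero.2 fun n => ?_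
  by_cases hs : n.sources = {z} ∆ {t}
  · have hnd : ¬ Disjoint (n.cluster z) T := fun hd => by
      rcases h with hz | ht
      · exact Finset.disjoint_left.1 hd (mem_cluster_self n z) hz
      · exact Finset.disjoint_left.1 hd (mem_cluster_of_sources_eq hs) ht
    rw [if_neg hnd, mul_zero]
  · rw [if_neg hs, zero_mul]

/-- `V(T)` resolved by the value of the cluster of `z`: `V(T) = ∑_{C : C ∩ T = ∅} M_∅[zt](C)` with the
cluster-conditioned masses `cmass` of `AizenmanWickSplice.lean`. [folklore] -/
theorem avoidMass_eq_sum_cmass (K : G.edgeFinset → ℝ) (z t : V) (T : Finset V) :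
    avoidMass K z t T =
      ∑ C : Finset V, cmass K ∅ ({z} ∆ {t}) z C * (if Disjoint C T then 1 else 0) := by
  unfold avoidMass
  rw [tsum_mul_apply_cluster_eq_sum (fun n : Current G => if n.sources = {z} ∆ {t} then n.eweight K else 0)
    (fun C => if Disjoint C T then 1 else 0) z]
  refine Finset.sum_congr rfl fun C _ => ?_
  congr 1
  unfold cmass
  refine tsum_congr fun n => ?_
  have hs : IsSupp (offGraph G ∅) n := isSupp_offGraph_empty n
  by_cases h1 : n.sources = {z} ∆ {t} <;> by_cases h2 : n.cluster z = C <;> simp [hs, h1, h2]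

/-- **The avoidance bound** (the "Griffiths' inequality [Gri67] and the trivial inclusion" step of
Aizenman–Duminil-Copin 2021, proof of Cor. A.2, cluster by cluster): for `K ≥ 0`,
`V(T) · Z_{G∖T}[∅] ≤ Z_{G∖T}[zt] · Z[∅]`, i.e. `P^{zt}[C_n(z) ∩ T = ∅] ≤ ⟨σ_zσ_t⟩_{Λ∖T}/⟨σ_zσ_t⟩_Λ`.
[cite: AizenmanDuminilCopinAnnals2021, arXiv:1912.07973 Appendix A.1, Corollary A.2, proof] -/
theorem avoidMass_mul_le (hK : ∀ e, 0 ≤ K e) (z t : V) (T : Finset V) :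
    avoidMass K z t T * ecurrentSumIn (offGraph G T) K ∅ ≤
      ecurrentSumIn (offGraph G T) K ({z} ∆ {t}) * ecurrentSum K ∅ := by
  rw [avoidMass_eq_sum_cmass, Finset.sum_mul, ← sum_cmass_eq K T ({z} ∆ {t}) z, Finset.sum_mul]
  refine Finset.sum_le_sum fun C _ => ?_
  by_cases hd : Disjoint C T
  swap
  · rw [if_neg hd, mul_zero, zero_mul]; exact bot_le
  rw [if_pos hd, mul_one]
  by_cases hz : z ∈ C
  swap
  · rw [cmass_eq_zero_of_not_mem_self K hz, zero_mul]; exact bot_le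
  by_cases ht : t ∈ C
  swap
  · rw [cmass_pair_eq_zero_of_not_mem K ht, zero_mul]; exact bot_le
  have hsub : ({z} : Finset V) ∆ {t} ⊆ C := fun w hw => by
    rcases eq_or_eq_of_mem_symmDiff_singleton hw with rfl | rfl
    · exact hz
    · exact ht
  exact cmass_empty_mul_le hK hd hsub

/-! ### Non-intersection masses at a frozen cluster -/

/-- The indicator `𝟙[z ∉ C_{n₁+n₂}(x)] 𝟙[t ∉ C_{n₁+n₂}(x)]`. [folklore] -/
def avoidInd (x z t : V) (p : Current G × Current G) : ℝ≥0∞ :=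
  disconnInd z x p * disconnInd t x p

/-- `avoidInd ≠ 0` forces `z, t ∉ C_{n₁+n₂}(x)`. [folklore] -/
theorem notMem_of_avoidInd_ne_zero {x z t : V} {p : Current G × Current G} (h : avoidInd x z t p ≠ 0) :
    z ∉ (p.1 + p.2).cluster x ∧ t ∉ (p.1 + p.2).cluster x := by
  unfold avoidInd disconnInd at h
  constructor
  · intro hz; rw [if_pos hz, zero_mul] at h; exact h rfl
  · intro ht; rw [if_pos ht, mul_zero] at h; exact h rfl

/-- `avoidInd = 1` when `z, t ∉ C_{n₁+n₂}(x)`. [folklore] -/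
theorem avoidInd_eq_one {x z t : V} {p : Current G × Current G} (hz : z ∉ (p.1 + p.2).cluster x)
    (ht : t ∉ (p.1 + p.2).cluster x) : avoidInd x z t p = 1 := by
  unfold avoidInd disconnInd
  rw [if_neg hz, if_neg ht, mul_one]

/-- Locality of `avoidInd` in the second current. [folklore] -/
theorem avoidInd_local (x z t : V) (n₁ n₂ n₂' : Current G)
    (h : ∀ e : G.edgeFinset, ¬ EdgeOff ((n₁ + n₂).cluster x) (e : Sym2 V) → n₂' e = n₂ e) :
    avoidInd x z t (n₁, n₂') = avoidInd x z t (n₁, n₂) := by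
  simp only [avoidInd, disconnInd, cluster_add_congr_right h]

/-- Under `∂n₂ = {z,t}`, `𝟙[z ∉ C(x)] = 𝟙[z ∉ C(x)]𝟙[t ∉ C(x)]` (the sources of `n₂` are connected).
[folklore] -/
theorem epairWeight_mul_disconnInd_eq (K : G.edgeFinset → ℝ) (x y z t : V) (p : Current G × Current G) :
    epairWeight K ({x} ∆ {y}) ({z} ∆ {t}) p * disconnInd z x p =
      epairWeight K ({x} ∆ {y}) ({z} ∆ {t}) p * avoidInd x z t p := by
  by_cases hs : p.2.sources = {z} ∆ {t}
  · by_cases hz : z ∈ (p.1 + p.2).cluster x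
    · simp only [avoidInd, disconnInd, if_pos hz, zero_mul, mul_zero]
    · have ht : t ∉ (p.1 + p.2).cluster x := fun ht => hz <| by
        have htz : z ∈ (p.1 + p.2).cluster t :=
          mem_cluster_comm.1 (mem_cluster_add_of_sources_eq_right p.1 hs)
        exact mem_cluster_trans ht htz
      rw [avoidInd_eq_one hz ht]
      simp only [disconnInd, if_neg hz]
  · rw [epairWeight_eq_mul, if_neg hs, mul_zero, zero_mul, zero_mul]

/-- **The two-current non-intersection mass at a frozen cluster** (Lemma A.1):
`∑ 1{∂n₁=xy}1{∂n₂=zt} w w 𝟙[z ∉ C_{n₁+n₂}(x)] = ∑_T inner(T) · Z_{G∖T}[zt]`.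
[cite: AizenmanDuminilCopinAnnals2021, arXiv:1912.07973 Appendix A.1, Corollary A.2, proof (first line)] -/
theorem tsum_epairWeight_pair_pair_mul_disconnInd_eq (hK : ∀ e, 0 ≤ K e) (x y z t : V) :
    ∑' p, epairWeight K ({x} ∆ {y}) ({z} ∆ {t}) p * disconnInd z x p =
      ∑ T : Finset V, (∑' r, clusterInner K x ({x} ∆ {y}) (avoidInd x z t) T r) *
        ecurrentSumIn (offGraph G T) K ({z} ∆ {t}) := by
  have h := tsum_epairWeight_mul_eq_sum_cluster hK x ({x} ∆ {y}) ({z} ∆ {t}) (avoidInd x z t)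
    (fun _ => 1) (avoidInd_local x z t) (fun n₁ n₂ _ _ hne => by
      obtain ⟨hz, ht⟩ := notMem_of_avoidInd_ne_zero hne
      exact Finset.disjoint_right.2 fun w hw hwC => by
        rcases eq_or_eq_of_mem_symmDiff_singleton hw with rfl | rfl
        · exact hz hwC
        · exact ht hwC)
  simp only [mul_one, one_mul] at h
  rw [← h]
  exact tsum_congr fun p => epairWeight_mul_disconnInd_eq K x y z t p

/-- **The three-current non-intersection mass at a frozen cluster** (Lemma A.1 with a cluster
functional): `∑ 1{∂n₁=xy}1{∂n₂=∅} w w V(C_{n₁+n₂}(x)) = ∑_T inner(T) · V(T) · Z_{G∖T}[∅]` with the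
avoidance mass `V`. [cite: AizenmanDuminilCopinAnnals2021, arXiv:1912.07973 Appendix A.1, Corollary A.2, proof (third line)] -/
theorem tsum_epairWeight_pair_empty_mul_avoidMass_eq (hK : ∀ e, 0 ≤ K e) (x y z t : V) :
    ∑' p, epairWeight K ({x} ∆ {y}) ∅ p * avoidMass K z t ((p.1 + p.2).cluster x) =
      ∑ T : Finset V, (∑' r, clusterInner K x ({x} ∆ {y}) (avoidInd x z t) T r) *
        (avoidMass K z t T * ecurrentSumIn (offGraph G T) K ∅) := by
  rw [← tsum_epairWeight_mul_eq_sum_cluster hK x ({x} ∆ {y}) ∅ (avoidInd x z t) (avoidMass K z t)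
    (avoidInd_local x z t) (fun _ _ _ _ _ => Finset.disjoint_empty_right _)]
  refine tsum_congr fun p => ?_
  congr 1
  by_cases hz : z ∈ (p.1 + p.2).cluster x
  · rw [avoidMass_eq_zero_of_mem K (Or.inl hz), mul_zero]
  by_cases ht : t ∈ (p.1 + p.2).cluster x
  · rw [avoidMass_eq_zero_of_mem K (Or.inr ht), mul_zero]
  rw [avoidInd_eq_one hz ht, one_mul]

/-- `𝟙[z ∈ C(x)] + 𝟙[z ∉ C(x)]`-splitting of `Z[xy] Z[zt]`. [folklore] -/
theorem tsum_inter_add_tsum_disconn (x y z t : V) :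
    (∑' p, epairWeight K ({x} ∆ {y}) ({z} ∆ {t}) p * (if z ∈ (p.1 + p.2).cluster x then 1 else 0)) +
      ∑' p, epairWeight K ({x} ∆ {y}) ({z} ∆ {t}) p * disconnInd z x p =
      ecurrentSum K ({x} ∆ {y}) * ecurrentSum K ({z} ∆ {t}) := by
  rw [← ENNReal.tsum_add, ← tsum_epairWeight]
  refine tsum_congr fun p => ?_
  rw [← mul_add]
  unfold disconnInd
  split_ifs <;> simp

/-- The three-current total mass splits into intersection and non-intersection:
`∑ 1{xy}1{∅} w w (∑ 1{zt} w 𝟙[C_n(z) ∩ C ≠ ∅]) + ∑ 1{xy}1{∅} w w V(C) = Z[xy] Z[∅] Z[zt]`. [folklore] -/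
theorem tsum_inter_three_add_tsum_avoidMass (x y z t : V) :
    (∑' p, epairWeight K ({x} ∆ {y}) ∅ p * ∑' n : Current G,
        (if n.sources = {z} ∆ {t} then n.eweight K else 0) *
          (if Disjoint (n.cluster z) ((p.1 + p.2).cluster x) then 0 else 1)) +
      ∑' p, epairWeight K ({x} ∆ {y}) ∅ p * avoidMass K z t ((p.1 + p.2).cluster x) =
      ecurrentSum K ({x} ∆ {y}) * ecurrentSum K ∅ * ecurrentSum K ({z} ∆ {t}) := by
  rw [← ENNReal.tsum_add]
  have h : ∀ p : Current G × Current G,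
      epairWeight K ({x} ∆ {y}) ∅ p * (∑' n : Current G,
          (if n.sources = {z} ∆ {t} then n.eweight K else 0) *
            (if Disjoint (n.cluster z) ((p.1 + p.2).cluster x) then 0 else 1)) +
        epairWeight K ({x} ∆ {y}) ∅ p * avoidMass K z t ((p.1 + p.2).cluster x) =
        epairWeight K ({x} ∆ {y}) ∅ p * ecurrentSum K ({z} ∆ {t}) := by
    intro p
    rw [← mul_add, avoidMass, ← ENNReal.tsum_add, ecurrentSum]
    congr 1
    refine tsum_congr fun n => ?_
    rw [← mul_add]
    split_ifs <;> simp
  rw [tsum_congr h, ENNReal.tsum_mul_right, tsum_epairWeight]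

/-- **Aizenman–Duminil-Copin 2021, Corollary A.2, first inequality (Aizenman 1982), finite volume,
current-sum form.** For `K ≥ 0` and vertices `x, y, z, t`:
`Z[∅] · ∑ 1{∂n₁=xy}1{∂n₂=zt} w w 𝟙[z ∈ C_{n₁+n₂}(x)]`
`≤ ∑ 1{∂n₁=xy}1{∂n₂=∅} w w ∑ 1{∂n₃=zt} w 𝟙[C_{n₃}(z) ∩ C_{n₁+n₂}(x) ≠ ∅]`, i.e.
`P^{xy,zt}[C_{n₁+n₂}(x) ∩ C_{n₁+n₂}(z) ≠ ∅] ≤ P^{xy,∅,zt}[C_{n₁+n₂}(x) ∩ C_{n₃}(z) ≠ ∅]` after division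
by `Z[xy]Z[zt]Z[∅]` (within one configuration `C(x) ∩ C(z) ≠ ∅ ⇔ z ∈ C(x)`).
[cite: AizenmanDuminilCopinAnnals2021, arXiv:1912.07973 Appendix A.1, Corollary A.2 (first inequality)] -/
theorem tsum_inter_pair_mul_le_three (hK : ∀ e, 0 ≤ K e) (x y z t : V) :
    (∑' p, epairWeight K ({x} ∆ {y}) ({z} ∆ {t}) p * (if z ∈ (p.1 + p.2).cluster x then 1 else 0)) *
        ecurrentSum K ∅ ≤
      ∑' p, epairWeight K ({x} ∆ {y}) ∅ p * ∑' n : Current G,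
        (if n.sources = {z} ∆ {t} then n.eweight K else 0) *
          (if Disjoint (n.cluster z) ((p.1 + p.2).cluster x) then 0 else 1) := by
  have hsplit2 := tsum_inter_add_tsum_disconn (K := K) x y z t
  have hsplit3 := tsum_inter_three_add_tsum_avoidMass (K := K) x y z t
  have hD2 := tsum_epairWeight_pair_pair_mul_disconnInd_eq hK x y z t
  have hD3 := tsum_epairWeight_pair_empty_mul_avoidMass_eq hK x y z t
  have hZ : ∀ S : Finset V, ecurrentSum K S ≠ ∞ := fun S => ecurrentSum_ne_top hK S
  -- the key comparison of the non-intersection masses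
  have key : ∑' p, epairWeight K ({x} ∆ {y}) ∅ p * avoidMass K z t ((p.1 + p.2).cluster x) ≤
      (∑' p, epairWeight K ({x} ∆ {y}) ({z} ∆ {t}) p * disconnInd z x p) * ecurrentSum K ∅ := by
    rw [hD3, hD2, Finset.sum_mul]
    refine Finset.sum_le_sum fun T _ => ?_
    calc (∑' r, clusterInner K x ({x} ∆ {y}) (avoidInd x z t) T r) *
          (avoidMass K z t T * ecurrentSumIn (offGraph G T) K ∅)
        ≤ (∑' r, clusterInner K x ({x} ∆ {y}) (avoidInd x z t) T r) *
          (ecurrentSumIn (offGraph G T) K ({z} ∆ {t}) * ecurrentSum K ∅) :=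
          mul_le_mul' le_rfl (avoidMass_mul_le hK z t T)
      _ = _ := by ring
  have hfinD : (∑' p, epairWeight K ({x} ∆ {y}) ({z} ∆ {t}) p * disconnInd z x p) ≠ ∞ :=
    ne_top_of_le_ne_top (ENNReal.mul_ne_top (hZ _) (hZ _)) (hsplit2 ▸ le_add_self)
  have hfin : (∑' p, epairWeight K ({x} ∆ {y}) ({z} ∆ {t}) p * disconnInd z x p) * ecurrentSum K ∅ ≠ ∞ :=
    ENNReal.mul_ne_top hfinD (hZ _)
  refine ENNReal.le_of_add_le_add_right hfin ?_
  calc (∑' p, epairWeight K ({x} ∆ {y}) ({z} ∆ {t}) p * (if z ∈ (p.1 + p.2).cluster x then 1 else 0)) *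
          ecurrentSum K ∅ +
        (∑' p, epairWeight K ({x} ∆ {y}) ({z} ∆ {t}) p * disconnInd z x p) * ecurrentSum K ∅
      = ((∑' p, epairWeight K ({x} ∆ {y}) ({z} ∆ {t}) p * (if z ∈ (p.1 + p.2).cluster x then 1 else 0)) +
          (∑' p, epairWeight K ({x} ∆ {y}) ({z} ∆ {t}) p * disconnInd z x p)) * ecurrentSum K ∅ := by
        ring
    _ = ecurrentSum K ({x} ∆ {y}) * ecurrentSum K ∅ * ecurrentSum K ({z} ∆ {t}) := by rw [hsplit2]; ring
    _ = _ := hsplit3.symm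
    _ ≤ _ := add_le_add le_rfl key

/-- **Aizenman–Duminil-Copin 2021, eq. (3.13) (the disentangling bound of Aizenman 1982), finite
volume, current-sum form.** For `K ≥ 0` and vertices `x, y, z, t`:
`Z[∅]² · ∑ 1{∂n₁=xy}1{∂n₂=zt} w w 𝟙[z ∈ C_{n₁+n₂}(x)]`
`≤ ∑ 1{∂n₁=xy}1{∂n₃=∅} 1{∂n₂=zt}1{∂n₄=∅} w⁴ 𝟙[C_{n₂+n₄}(z) ∩ C_{n₁+n₃}(x) ≠ ∅]`, i.e.
`P^{xy,zt}[C_{n₁+n₂}(x) ∩ C_{n₁+n₂}(z) ≠ ∅] ≤ P^{xy,zt,∅,∅}[C_{n₁+n₃}(x) ∩ C_{n₂+n₄}(z) ≠ ∅]` after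
division by `Z[xy]Z[zt]Z[∅]²`: the intersection probability only increases when the two clusters are
replaced by independently distributed ones. With `Current.ursellFour_currentSum_identity` this is (3.14),
`|U₄(x,y,z,t)| ≤ 2⟨σ_xσ_y⟩⟨σ_zσ_t⟩ P^{xy,zt,∅,∅}[C_{n₁+n₃}(x) ∩ C_{n₂+n₄}(z) ≠ ∅]`.
[cite: AizenmanDuminilCopinAnnals2021, arXiv:1912.07973 §3.2, the display P^{xy,zt} ≤ P^{xy,zt,∅,∅} following (3.12) (= (3.13)) and Cor. A.2] -/
theorem tsum_inter_pair_mul_sq_le_four (hK : ∀ e, 0 ≤ K e) (x y z t : V) :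
    (∑' p, epairWeight K ({x} ∆ {y}) ({z} ∆ {t}) p * (if z ∈ (p.1 + p.2).cluster x then 1 else 0)) *
        ecurrentSum K ∅ ^ 2 ≤
      ∑' p, ∑' q, epairWeight K ({x} ∆ {y}) ∅ p * epairWeight K ({z} ∆ {t}) ∅ q *
        (if Disjoint ((q.1 + q.2).cluster z) ((p.1 + p.2).cluster x) then 0 else 1) := by
  have h1 := tsum_inter_pair_mul_le_three hK x y z t
  -- adding a sourceless current only enlarges `C(z)`
  have hmono : ∀ (T : Finset V) (q : Current G × Current G),
      (if Disjoint (q.1.cluster z) T then (0 : ℝ≥0∞) else 1) ≤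
        (if Disjoint ((q.1 + q.2).cluster z) T then 0 else 1) := by
    intro T q
    by_cases h : Disjoint ((q.1 + q.2).cluster z) T
    · rw [if_pos h, if_pos (h.mono_left (cluster_mono (self_le_add_right q.1 q.2) z))]
    · rw [if_neg h]; split_ifs <;> simp
  have inner : ∀ T : Finset V, (∑' n : Current G, (if n.sources = {z} ∆ {t} then n.eweight K else 0) *
      (if Disjoint (n.cluster z) T then 0 else 1)) * ecurrentSum K ∅ ≤
      ∑' q, epairWeight K ({z} ∆ {t}) ∅ q * (if Disjoint ((q.1 + q.2).cluster z) T then 0 else 1) := by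
    intro T
    rw [ecurrentSum, tsum_mul_tsum_eq_tsum_prod]
    refine ENNReal.tsum_le_tsum fun q => ?_
    rw [epairWeight_eq_mul]
    calc (if q.1.sources = {z} ∆ {t} then q.1.eweight K else 0) *
          (if Disjoint (q.1.cluster z) T then 0 else 1) * (if q.2.sources = ∅ then q.2.eweight K else 0)
        = (if q.1.sources = {z} ∆ {t} then q.1.eweight K else 0) *
          (if q.2.sources = ∅ then q.2.eweight K else 0) * (if Disjoint (q.1.cluster z) T then 0 else 1) := by
          ring
      _ ≤ _ := mul_le_mul' le_rfl (hmono T q)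
  calc (∑' p, epairWeight K ({x} ∆ {y}) ({z} ∆ {t}) p * (if z ∈ (p.1 + p.2).cluster x then 1 else 0)) *
          ecurrentSum K ∅ ^ 2
      = (∑' p, epairWeight K ({x} ∆ {y}) ({z} ∆ {t}) p * (if z ∈ (p.1 + p.2).cluster x then 1 else 0)) *
          ecurrentSum K ∅ * ecurrentSum K ∅ := by ring
    _ ≤ (∑' p, epairWeight K ({x} ∆ {y}) ∅ p * ∑' n : Current G,
          (if n.sources = {z} ∆ {t} then n.eweight K else 0) *
            (if Disjoint (n.cluster z) ((p.1 + p.2).cluster x) then 0 else 1)) * ecurrentSum K ∅ :=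
        mul_le_mul' h1 le_rfl
    _ = ∑' p, epairWeight K ({x} ∆ {y}) ∅ p * ((∑' n : Current G,
          (if n.sources = {z} ∆ {t} then n.eweight K else 0) *
            (if Disjoint (n.cluster z) ((p.1 + p.2).cluster x) then 0 else 1)) * ecurrentSum K ∅) := by
        rw [← ENNReal.tsum_mul_right]
        exact tsum_congr fun p => by ring
    _ ≤ ∑' p, epairWeight K ({x} ∆ {y}) ∅ p * ∑' q, epairWeight K ({z} ∆ {t}) ∅ q *
          (if Disjoint ((q.1 + q.2).cluster z) ((p.1 + p.2).cluster x) then 0 else 1) :=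
        ENNReal.tsum_le_tsum fun p => mul_le_mul' le_rfl (inner _)
    _ = _ := by
        refine tsum_congr fun p => ?_
        rw [← ENNReal.tsum_mul_left]
        exact tsum_congr fun q => by ring

end Current

end Literature.Probability.LatticeModels
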